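import Literature.NumberTheory.Transcendental.GammaIsoCrossTransfer
import Literature.NumberTheory.Transcendental.ZilberFieldSaturationMain
import Literature.FieldTheory.Kummer.DivisionSequencesProofs
import HarnessLib

/-!
# Cross-field `ℵ₀`-saturation for Γ-algebraic extensions, main (free) case

M. Bays, J. Kirby, *Pseudo-exponential maps, variants, and quasiminimality*, Algebra & Number
Theory 12 (2018), Lemma 8.3 (⟹) with Def. 5.14: a field `F` satisfying axioms 1–4 of
`ECF_SK` / `ΓCF` is `ℵ₀`-saturated for Γ-algebraic extensions — *whenever `F_base ◁ A ◁ F` with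
`A` finitely generated and `A ◁ B` is a finitely generated Γ-algebraic extension, `B` embeds
(strongly) into `F` over `A`* — where `B` is an ABSTRACT extension of `A`. The tree proves this
with `B` presented inside the same field `F`
(`ZilberSaturationMain.exists_isGammaIso_append_of_free`, `ZilberFieldSaturationMain.lean`, and
its sequels): enough for homogeneity inside one Zilber field, not for comparing two of them.
Zilber's categoricity theorem (`zilber_categoricity`; Bays–Kirby Thm 9.1; Haykazyan 2016, Thm 16
via `Literature.ModelTheory.Quasiminimal.IsQuasiminimalPregeometryClass`, whose axioms are
homogeneity statements ACROSS two members) needs the extension presented in ANOTHER field. This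
file proves that cross-field main case, porting the one-field proof step by step:

* `GammaField.pointHom₂`, `GammaField.pointFieldHom₂` — the embeddings `k[b] → L'`,
  `k(b) → L'` along a base embedding `σ : k → L'` with `b ↦ b'`, for `b` in `L ⊇ k` and `b'` in
  a second field `L'` (two-target form of `GammaField.pointHom`/`pointFieldHom`);
* `ZilberSaturationMain.exists_generic_partner₂` — the SEAC step: for a cross Γ-isomorphism
  `θ : ⟨K₁ c⟩ ≅ ⟨K₂ c'⟩` (`c` in `F₁`, `c'` in `F₂`, `GammaField.IsGammaIsoTw₂`) and a free
  rotund locus over `⟨K₁ c⟩` of dimension `k` (data computed in `F₁`), strong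
  exponential-algebraic closedness of `F₂` yields a generic point `(x, exp x)` of the transported
  locus with `x` linearly independent over `K₂ + ℚc'` and `td(x/K₂ + ℚc') = k`;
* `ZilberSaturationMain.psi₂`, `ZilberSaturationMain.iota₂` — the field embedding
  `⟨K₁ c⟩((a, exp a)) → F₂` over `θ` with `(a, exp a) ↦ (x, exp x)`;
* `ZilberSaturationMain.exists_ringHom_isoCore₂` — the isomorphism step (good basis ⟹
  embedding of `⟨K₁ c, e⟩` into `F₂` over `θ`), through the Kummer fact
  `Literature.FieldTheory.Kummer.BaysKirby2018_divisionSequences_determined` (already stated for a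
  division system in ANY extension field `Ω₂` of the base, here `Ω₂ = F₂`);
* `ZilberSaturationMain.exists_isGammaIsoTw₂_append_of_free` — **the cross-field main case**:
  `F₁` with `ker exp = τ₁ℤ`, `F₂` algebraically closed and strongly exponentially-algebraically
  closed, `σ₀ : ℚ^{ab}(τ₁) ≅ ℚ^{ab}(τ₂)` an isomorphism of base Γ-fields
  (`GammaField.IsEBaseIso₂`), `c ↦ c'` a cross Γ-isomorphism over `σ₀` with `ℚτ₁ + ℚc ◁ F₁`,
  `ℚτ₂ + ℚc' ◁ F₂`, and `e` a free Γ-algebraic basis over `ℚτ₁ + ℚc` in `F₁`; then there is `e'`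
  in `F₂` with `(c, e) ↦ (c', e')` a cross Γ-isomorphism over `σ₀` and `ℚτ₂ + ℚc' + ℚe' ◁ F₂`.
  Granted the Kummer fact as a hypothesis (as in the one-field file) and unconditionally
  (`…_of_free'`, from `BaysKirby2018_divisionSequences_determined_holds`).

All source-side computations (good basis, locus data, rotundity, freeness, `δ = 0`) are the
one-field lemmas of `ZilberFieldSaturationMain.lean` applied in `F₁`; the transport of the locus
ideal along `θ` is `LocusComponents` (abstract coefficient fields); the target-side steps use
`F₂` only. Everything is proved.

## References

* M. Bays, J. Kirby, *Pseudo-exponential maps, variants, and quasiminimality*, Algebra & Number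
  Theory 12 (2018) 493–549: Def. 3.19, Prop. 3.22, Lemma 4.8, Def. 5.14, Prop. 7.3, Cor. 7.4,
  Lemma 8.3, Thm 8.2, Thm 9.1.
* L. Haykazyan, *Categoricity in quasiminimal pregeometry classes*, J. Symbolic Logic 81 (2016):
  Def. 2 (IV).
* B. Zilber, *Pseudo-exponentiation on algebraically closed fields of characteristic zero*,
  Ann. Pure Appl. Logic 132 (2005): Thm 1.1, §5.
-/

noncomputable section

open Set MvPolynomial

universe u

namespace Literature.NumberTheory.Transcendental

/-! ### Embeddings of `k[b]` and `k(b)` along a base embedding into a second field -/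

namespace GammaField

section PointHom₂

open ZilberHomogeneity
open scoped IntermediateField.algebraAdjoinAdjoin

variable {k L L' : Type*} [Field k] [Field L] [Field L'] [Algebra k L] {ι : Type*}

/-- **The homomorphism `k[b] → L'` along `σ : k → L'` with `b ↦ b'`** (`b` a point of `L ⊇ k`,
`b'` a point of a second field `L'`), defined as soon as every polynomial relation of `b` over
`k` is, after transport of coefficients by `σ`, a relation of `b'`: `p(b) ↦ p^σ(b')`. The
two-target form of `GammaField.pointHom`. [folklore] -/
def pointHom₂ (σ : k →+* L') (b : ι → L) (b' : ι → L')
    (hle : ∀ p : MvPolynomial ι k, aeval b p = 0 → eval₂ σ b' p = 0) :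
    Algebra.adjoin k (range b) →+* L' :=
  (aevalCod k b).toRingHom.liftOfSurjective (aevalCod_surjective b)
    ⟨eval₂Hom σ b', fun p hp => by
      rw [RingHom.mem_ker, coe_eval₂Hom]
      exact hle p ((mem_ker_aevalCod_iff b p).1 hp)⟩

/-- `pointHom₂ σ b b'` sends `p(b) ↦ p^σ(b')`. [folklore] -/
theorem pointHom₂_aevalCod (σ : k →+* L') (b : ι → L) (b' : ι → L')
    (hle : ∀ p : MvPolynomial ι k, aeval b p = 0 → eval₂ σ b' p = 0) (p : MvPolynomial ι k) :
    pointHom₂ σ b b' hle (aevalCod k b p) = eval₂ σ b' p :=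
  (aevalCod k b).toRingHom.liftOfRightInverse_comp_apply _ _ _ p

/-- `pointHom₂ σ b b'` on an element `p(b)` of `k[b]` given with any membership proof. [folklore] -/
theorem pointHom₂_apply_aeval (σ : k →+* L') (b : ι → L) (b' : ι → L')
    (hle : ∀ p : MvPolynomial ι k, aeval b p = 0 → eval₂ σ b' p = 0) (p : MvPolynomial ι k)
    (hp : aeval b p ∈ Algebra.adjoin k (range b)) :
    pointHom₂ σ b b' hle ⟨aeval b p, hp⟩ = eval₂ σ b' p :=
  pointHom₂_aevalCod σ b b' hle p

/-- `pointHom₂ σ b b'` is `σ` on `k`. [folklore] -/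
theorem pointHom₂_algebraMap (σ : k →+* L') (b : ι → L) (b' : ι → L')
    (hle : ∀ p : MvPolynomial ι k, aeval b p = 0 → eval₂ σ b' p = 0) (z : k) :
    pointHom₂ σ b b' hle (algebraMap k _ z) = σ z := by
  have : algebraMap k (Algebra.adjoin k (range b)) z = aevalCod k b (C z) :=
    Subtype.ext (by simp)
  rw [this, pointHom₂_aevalCod, eval₂_C]

/-- `pointHom₂ σ b b'` sends `bᵢ ↦ b'ᵢ`. [folklore] -/
theorem pointHom₂_apply_self (σ : k →+* L') (b : ι → L) (b' : ι → L')
    (hle : ∀ p : MvPolynomial ι k, aeval b p = 0 → eval₂ σ b' p = 0) (i : ι) :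
    pointHom₂ σ b b' hle ⟨b i, Algebra.subset_adjoin (mem_range_self i)⟩ = b' i := by
  have : (⟨b i, Algebra.subset_adjoin (mem_range_self i)⟩ : Algebra.adjoin k (range b)) =
      aevalCod k b (X i) := Subtype.ext (by simp)
  rw [this, pointHom₂_aevalCod, eval₂_X]

/-- If conversely every relation of `b'` comes from one of `b`, then `pointHom₂ σ b b'` is
injective. [folklore] -/
theorem pointHom₂_injective (σ : k →+* L') (b : ι → L) (b' : ι → L')
    (hiff : ∀ p : MvPolynomial ι k, aeval b p = 0 ↔ eval₂ σ b' p = 0) :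
    Function.Injective (pointHom₂ σ b b' fun p => (hiff p).1) := by
  rw [injective_iff_map_eq_zero]
  intro z hz
  obtain ⟨p, rfl⟩ := aevalCod_surjective b z
  rw [pointHom₂_aevalCod] at hz
  exact Subtype.ext ((hiff p).2 hz)

/-- **The field embedding `k(b) → L'` along `σ` with `b ↦ b'`** when `b` and `b'` have
corresponding ideals: the extension of `pointHom₂` to the fraction field `k(b)` of `k[b]`.
[folklore] -/
def pointFieldHom₂ (σ : k →+* L') (b : ι → L) (b' : ι → L')
    (hiff : ∀ p : MvPolynomial ι k, aeval b p = 0 ↔ eval₂ σ b' p = 0) :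
    IntermediateField.adjoin k (range b) →+* L' :=
  IsFractionRing.lift (A := Algebra.adjoin k (range b)) (pointHom₂_injective σ b b' hiff)

/-- `pointFieldHom₂` extends `pointHom₂`. [folklore] -/
theorem pointFieldHom₂_of_mem_adjoin (σ : k →+* L') (b : ι → L) (b' : ι → L')
    (hiff : ∀ p : MvPolynomial ι k, aeval b p = 0 ↔ eval₂ σ b' p = 0) {z : L}
    (hz : z ∈ Algebra.adjoin k (range b)) :
    pointFieldHom₂ σ b b' hiff ⟨z, IntermediateField.algebra_adjoin_le_adjoin _ _ hz⟩ =
      pointHom₂ σ b b' (fun p => (hiff p).1) ⟨z, hz⟩ := by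
  have := IsFractionRing.lift_algebraMap (A := Algebra.adjoin k (range b))
    (K := IntermediateField.adjoin k (range b)) (pointHom₂_injective σ b b' hiff) ⟨z, hz⟩
  exact this

/-- `pointFieldHom₂` is `σ` on `k`. [folklore] -/
theorem pointFieldHom₂_algebraMap (σ : k →+* L') (b : ι → L) (b' : ι → L')
    (hiff : ∀ p : MvPolynomial ι k, aeval b p = 0 ↔ eval₂ σ b' p = 0) (z : k) :
    pointFieldHom₂ σ b b' hiff (algebraMap k _ z) = σ z := by
  have hz : algebraMap k L z ∈ Algebra.adjoin k (range b) := (Algebra.adjoin k (range b)).algebraMap_mem z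
  rw [show algebraMap k (IntermediateField.adjoin k (range b)) z =
    ⟨algebraMap k L z, IntermediateField.algebra_adjoin_le_adjoin _ _ hz⟩ from rfl,
    pointFieldHom₂_of_mem_adjoin]
  exact pointHom₂_algebraMap σ b b' _ z

/-- `pointFieldHom₂` sends `bᵢ ↦ b'ᵢ`. [folklore] -/
theorem pointFieldHom₂_apply_self (σ : k →+* L') (b : ι → L) (b' : ι → L')
    (hiff : ∀ p : MvPolynomial ι k, aeval b p = 0 ↔ eval₂ σ b' p = 0) (i : ι) :
    pointFieldHom₂ σ b b' hiff ⟨b i, IntermediateField.subset_adjoin _ _ (mem_range_self i)⟩ =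
      b' i := by
  rw [show (⟨b i, IntermediateField.subset_adjoin _ _ (mem_range_self i)⟩ :
      IntermediateField.adjoin k (range b)) =
    ⟨b i, IntermediateField.algebra_adjoin_le_adjoin _ _ (Algebra.subset_adjoin (mem_range_self i))⟩
    from rfl, pointFieldHom₂_of_mem_adjoin]
  exact pointHom₂_apply_self σ b b' _ i

end PointHom₂

end GammaField

namespace ZilberSaturationMain

open GammaField Literature.ModelTheory.ExponentialFields.ExponentialRing

/-! ### The strong-exponential-closedness step: a generic partner in the second field -/

section SEACStep₂

variable {F₁ : Type u} [Field F₁] [CharZero F₁] [Literature.ModelTheory.ExponentialFields.ExponentialRing F₁]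
variable {F₂ : Type u} [Field F₂] [CharZero F₂] [Literature.ModelTheory.ExponentialFields.ExponentialRing F₂]
variable (K₁ : Submodule ℚ F₁) (K₂ : Submodule ℚ F₂) {σ : fieldOf K₁ ≃+* fieldOf K₂} {N : ℕ}
  {c : Fin N → F₁} {c' : Fin N → F₂} (hiso : IsGammaIsoTw₂ σ c c') {k : ℕ} (a : Fin k → F₁)

/-- The locus ideal of `(a, exp a)` over `⟨K₁ c⟩` transported to the `c'` side, in the second
field, along the cross Γ-isomorphism `θ : ⟨K₁ c⟩ ≅ ⟨K₂ c'⟩`.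
[cite: BaysKirby2018ANT, Def. 3.19 (`loc(b'/A) = loc(b/A)`)] -/
abbrev locusIdeal₂' : Ideal (MvPolynomial (Fin k ⊕ Fin k) (bfld K₂ c')) :=
  LocusComponents.idealMapCoeff hiso.fieldEquiv (locusIdeal K₁ c a)

/-- `P'` is prime. [folklore] -/
theorem locusIdeal₂'_isPrime : (locusIdeal₂' K₁ K₂ hiso a).IsPrime :=
  LocusComponents.idealMapCoeff_isPrime _ _

variable [IsAlgClosed F₂]

set_option synthInstance.maxHeartbeats 200000 in
set_option maxHeartbeats 400000 in
/-- **The generic partner, in the second field.** Let `K₁ + ℚc ◁ F₁`, `K₂ + ℚc' ◁ F₂`,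
`θ : ⟨K₁ c⟩ ≅ ⟨K₂ c'⟩` a cross Γ-isomorphism, `a` a `k`-tuple of `F₁` linearly independent over
`K₁ + ℚc` with `td(a/K₁ + ℚc) = k` whose locus over `⟨K₁ c⟩` is free, and let `K₂ + ℚc'` be
spanned by a finite set `T`. If `F₂` is algebraically closed and strongly exponentially-
algebraically closed, there is `x` in `F₂` with `(x, exp x)` a generic point of
`θ(loc((a, exp a)/⟨K₁ c⟩))` over `⟨K₂ c'⟩`, `x` linearly independent over `K₂ + ℚc'`, and
`td(x/K₂ + ℚc') = k` (Bays–Kirby 2018, Lemma 8.3 (⟹): axiom 4 of `F₂` applied to a component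
of the base change of `V = loc(b/A)`, transported along `A ≅ A'`).
[cite: BaysKirby2018ANT, Lemma 8.3 (proof)] -/
theorem exists_generic_partner₂ (hSEAC : IsStronglyExpAlgClosed F₂)
    (hX : IsStrong (K₁ ⊔ Submodule.span ℚ (range c)))
    (hX' : IsStrong (K₂ ⊔ Submodule.span ℚ (range c')))
    (ha : LinIndepOver (K₁ ⊔ Submodule.span ℚ (range c)) a)
    (htd : td (K₁ ⊔ Submodule.span ℚ (range c)) (Submodule.span ℚ (range a)) = k)
    (hfree : ∀ m : Fin k → ℤ, m ≠ 0 →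
      ∑ j, (m j : ℚ) • a j ∉ acl (gens (K₁ ⊔ Submodule.span ℚ (range c))) ∧
      exp (∑ j, (m j : ℚ) • a j) ∉ acl (gens (K₁ ⊔ Submodule.span ℚ (range c))))
    (T : Finset F₂) (hT : Submodule.span ℚ (↑T : Set F₂) = K₂ ⊔ Submodule.span ℚ (range c')) :
    ∃ x : Fin k → F₂, IsGenericPt (locusIdeal₂' K₁ K₂ hiso a) (gammaPt x) ∧
      LinIndepOver (K₂ ⊔ Submodule.span ℚ (range c')) x ∧
      td (K₂ ⊔ Submodule.span ℚ (range c')) (Submodule.span ℚ (range x)) = k := by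
  classical
  set X' := K₂ ⊔ Submodule.span ℚ (range c') with hX'def
  set θ := hiso.fieldEquiv with hθ
  set P := locusIdeal K₁ c a with hP
  set P' : Ideal (MvPolynomial (Fin k ⊕ Fin k) (bfld K₂ c')) := locusIdeal₂' K₁ K₂ hiso a with hP'
  haveI : P'.IsPrime := locusIdeal₂'_isPrime K₁ K₂ hiso a
  -- a component `Z(Q)` of `Z(P')_{F₂}`
  obtain ⟨Q, hQ⟩ := LocusComponents.exists_mem_minimalPrimes_map (k := bfld K₂ c') (F := F₂) (P := P')
  haveI : Q.IsPrime := hQ.1.1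
  set W : Set (Fin k ⊕ Fin k → F₂) := zeroLocus F₂ Q with hW
  -- data on the generic point of `P`, transported to `P'`
  have hY : ∀ i, (MvPolynomial.X (Sum.inr i) : MvPolynomial (Fin k ⊕ Fin k) (bfld K₂ c')) ∉ P' :=
    fun i => (LocusComponents.X_inr_notMem_mapCoeff_iff θ P i).2 (X_inr_notMem_locusIdeal K₁ c a i)
  have hrot : ∀ M : Matrix (Fin k) (Fin k) ℤ,
      ∃ s : Fin (M.map (Int.cast : ℤ → ℚ)).rank → Fin k ⊕ Fin k,
        AlgebraicIndependent (bfld K₂ c') fun i => matrixAct M (genericPt P') (s i) := by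
    intro M
    obtain ⟨s, hs⟩ := exists_algebraicIndependent_matrixAct K₁ c a hX ha M
    refine ⟨s, LocusComponents.algebraicIndependent_matrixAct_genericPt_mapCoeff θ P M s ?_⟩
    exact LocusComponents.algebraicIndependent_matrixAct_genericPt P (isGenericPt_locusIdeal K₁ c a)
      M s hs
  have hadd : ∀ m : Fin k → ℤ, m ≠ 0 → Transcendental (bfld K₂ c')
      (∑ i, (m i : zeroLocusFunctionField P') * genericPt P' (Sum.inl i)) := by
    intro m hm
    refine LocusComponents.transcendental_sum_genericPt_mapCoeff θ P m ?_
    exact LocusComponents.transcendental_sum_genericPt P (isGenericPt_locusIdeal K₁ c a) m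
      (transcendental_sum K₁ c a m (hfree m hm).1)
  have hmul : ∀ m : Fin k → ℤ, m ≠ 0 → Transcendental (bfld K₂ c')
      (∏ i, genericPt P' (Sum.inr i) ^ m i) := by
    intro m hm
    refine LocusComponents.transcendental_prod_genericPt_mapCoeff θ P m ?_
    exact LocusComponents.transcendental_prod_genericPt P (isGenericPt_locusIdeal K₁ c a) m
      (transcendental_prod K₁ c a m (hfree m hm).2)
  -- the hypotheses of strong exponential-algebraic closedness for `W = Z(Q)`
  have hirr : IsIrreducibleClosed F₂ W := LocusComponents.isIrreducibleClosed_component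
  have hne : (W ∩ torusLocus F₂ k).Nonempty :=
    LocusComponents.component_inter_torusLocus_nonempty hQ hY
  have hrotW : IsRotund F₂ k (W ∩ torusLocus F₂ k) := LocusComponents.isRotund_component hQ hY hrot
  have haddW : IsAddFree F₂ k (W ∩ torusLocus F₂ k) := LocusComponents.isAddFree_component hQ hY hadd
  have hmulW : IsMulFree F₂ k (W ∩ torusLocus F₂ k) := LocusComponents.isMulFree_component hQ hY hmul
  have hdimP : ringKrullDim (zeroLocusCoordRing P) = k := ringKrullDim_coordRing_locusIdeal_eq K₁ c a htd
  have hdimP' : ringKrullDim (zeroLocusCoordRing P') = k := by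
    rw [hP', locusIdeal₂', LocusComponents.ringKrullDim_quotient_mapCoeff]; exact hdimP
  have hdimW : zariskiDim F₂ W = k := by
    rw [hW, LocusComponents.zariskiDim_component hQ]; exact hdimP'
  -- Kirby's scheme: a point `(x, exp x) ∈ W` with `x` integrally independent over `span T`
  obtain ⟨z, ⟨hzW, hzexp⟩, hzlin⟩ :=
    hSEAC.isLinIndepExpAlgClosed k W hirr hne hrotW haddW hmulW hdimW T
  set x : Fin k → F₂ := z ∘ Sum.inl with hx
  have hz : z = gammaPt x := (mem_expGraph_iff_eq_gammaPt z).1 hzexp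
  have hlin : LinIndepOver X' x := linIndepOver_of_forall_intCast T hT hzlin
  -- `td(x/X') ≥ k` by strongness of `X'`
  have hfg : IsFG X' (Submodule.span ℚ (range x)) := isFG_span_of_finite X' (finite_range x)
  have hδ : 0 ≤ predim X' (Submodule.span ℚ (range x)) := (isStrong_iff.1 hX') _ hfg
  have hldim : ldim X' (Submodule.span ℚ (range x)) = k := ldim_span_eq_of_linIndepOver hlin
  have htd_ge : (k : ℕ∞) ≤ td X' (Submodule.span ℚ (range x)) := by
    rw [predim_def, hldim] at hδ
    have h1 : k ≤ (td X' (Submodule.span ℚ (range x))).toNat := by omega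
    rw [← ENat.coe_toNat (td_ne_top hfg)]
    exact_mod_cast h1
  -- relative rank of the coordinates of `(x, exp x)` over `⟨K₂ c'⟩`
  have hrel : (algMatroid F₂).relRank (((bfld K₂ c').restrictScalars ℚ : IntermediateField ℚ F₂) : Set F₂)
      (range (gammaPt x)) = td X' (Submodule.span ℚ (range x)) := relRank_range_gammaPt K₂ c' x
  -- genericity
  have hzP' : gammaPt x ∈ zeroLocus F₂ P' := by
    rw [← hz]; exact LocusComponents.zeroLocus_subset_zeroLocus hQ hzW
  have htrP' : Algebra.trdeg (bfld K₂ c') (zeroLocusCoordRing P') = k := by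
    have h1 := Literature.RingTheory.KrullDimension.ringKrullDim_eq_trdeg (bfld K₂ c') (zeroLocusCoordRing P')
    rw [hdimP'] at h1
    have h2 : Cardinal.toNat (Algebra.trdeg (bfld K₂ c') (zeroLocusCoordRing P')) = k := by
      exact_mod_cast h1.symm
    rw [Literature.RingTheory.KrullDimension.trdeg_eq_toNat (bfld K₂ c') (zeroLocusCoordRing P'), h2]
  have hgen : IsGenericPt P' (gammaPt x) := by
    refine LocusComponents.isGenericPt_of_trdeg_le P' hzP' ?_
    rw [htrP']
    refine Cardinal.natCast_le_toENat.1 ?_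
    rw [toENat_trdeg_adjoin_bfld, hrel]
    exact htd_ge
  -- `td(x/X') = k`
  have htd_eq : td X' (Submodule.span ℚ (range x)) = k := by
    refine le_antisymm ?_ htd_ge
    rw [← hrel, ← toENat_trdeg_adjoin_bfld, ← trdeg_coordRing_eq_of_isGenericPt hgen, htrP',
      Cardinal.toENat_nat]
  exact ⟨x, hgen, hlin, htd_eq⟩

end SEACStep₂

/-! ### The embeddings attached to the locus and to its generic partner in the second field -/

section Embeddings₂

variable {F₁ : Type u} [Field F₁] {F₂ : Type u} [Field F₂]
variable (kk : Type u) {kk' : Type u} [Field kk] [Field kk'] [Algebra kk F₁] [Algebra kk' F₂]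
  (θ : kk ≃+* kk') {n : ℕ} (p : Fin n ⊕ Fin n → F₁) {z : Fin n ⊕ Fin n → F₂}

variable (hgen : IsGenericPt (LocusComponents.idealMapCoeff θ (locIdeal kk p)) z)

/-- **`Ψ : kk(loc) → F₂`**, the embedding through `θ : kk ≅ kk'` and a generic point `z` of
`loc^θ` over `kk'` in the second field. [cite: BaysKirby2018ANT, Def. 3.19] -/
def psi₂ : locFF kk p →+* F₂ :=
  (LocusComponents.liftOfIsGenericPt _ hgen).toRingHom.comp
    (LocusComponents.funcFieldEquiv θ (locIdeal kk p)).toRingHom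

/-- `Ψ` on the generic point. [folklore] -/
@[simp] theorem psi₂_genericPt (j : Fin n ⊕ Fin n) :
    psi₂ kk θ p hgen (genericPt (locIdeal kk p) j) = z j := by
  simp [psi₂]

/-- `Ψ` on scalars is `θ`. [folklore] -/
@[simp] theorem psi₂_algebraMap (y : kk) :
    psi₂ kk θ p hgen (algebraMap kk (locFF kk p) y) = algebraMap kk' F₂ (θ y) := by
  simp only [psi₂, RingHom.coe_comp, Function.comp_apply, RingEquiv.toRingHom_eq_coe,
    RingEquiv.coe_toRingHom, AlgHom.toRingHom_eq_coe, AlgHom.coe_toRingHom]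
  rw [LocusComponents.funcFieldEquiv_algebraMap]
  exact (LocusComponents.liftOfIsGenericPt _ hgen).commutes _

/-- **`ι : kk(p) → F₂`**, `Ψₚ y ↦ Ψ y`: the field embedding over `θ` sending `p ↦ z`, from a
subfield of `F₁` into `F₂`. [cite: BaysKirby2018ANT, Def. 3.19] -/
def iota₂ : Rfld kk p →+* F₂ := (psi₂ kk θ p hgen).comp (eR kk p).symm.toRingHom

/-- `ι (Ψₚ y) = Ψ y`. [folklore] -/
theorem iota₂_apply_psiP (y : locFF kk p) (h : psiP kk p y ∈ Rfld kk p) :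
    iota₂ kk θ p hgen ⟨psiP kk p y, h⟩ = psi₂ kk θ p hgen y := by
  simp only [iota₂, RingHom.coe_comp, Function.comp_apply, RingEquiv.toRingHom_eq_coe,
    RingEquiv.coe_toRingHom]
  congr 1
  rw [RingEquiv.symm_apply_eq]
  exact Subtype.ext rfl

/-- `ι` is `θ` on scalars. [folklore] -/
theorem iota₂_algebraMap (y : kk) :
    iota₂ kk θ p hgen ⟨algebraMap kk F₁ y, algebraMap_mem_Rfld kk p y⟩ = algebraMap kk' F₂ (θ y) := by
  have h := iota₂_apply_psiP kk θ p hgen (algebraMap kk (locFF kk p) y)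
    (by rw [psiP_algebraMap]; exact algebraMap_mem_Rfld kk p y)
  rw [psi₂_algebraMap] at h
  rw [← h]
  congr 1
  exact Subtype.ext (psiP_algebraMap kk p y).symm

/-- `ι pⱼ = zⱼ`. [folklore] -/
theorem iota₂_apply_coord (j : Fin n ⊕ Fin n) :
    iota₂ kk θ p hgen ⟨p j, apply_mem_Rfld kk p j⟩ = z j := by
  have h := iota₂_apply_psiP kk θ p hgen (genericPt (locIdeal kk p) j)
    (by rw [psiP_genericPt]; exact apply_mem_Rfld kk p j)
  rw [psi₂_genericPt] at h
  rw [← h]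
  congr 1
  exact Subtype.ext (psiP_genericPt kk p j).symm

/-- `ι (N pⱼ) = N zⱼ`. [folklore] -/
theorem iota₂_natCast_mul (M : ℕ) (j : Fin n ⊕ Fin n) :
    iota₂ kk θ p hgen ⟨(M : F₁) * p j, natCast_mul_mem_Rfld kk p M j⟩ = (M : F₂) * z j := by
  have h1 : (⟨(M : F₁) * p j, natCast_mul_mem_Rfld kk p M j⟩ : Rfld kk p) =
      (M : Rfld kk p) * ⟨p j, apply_mem_Rfld kk p j⟩ :=
    Subtype.ext (by simp)
  rw [h1, map_mul, map_natCast, iota₂_apply_coord]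

end Embeddings₂

/-! ### The core of the isomorphism step, into the second field -/

section IsoCore₂

open Literature.FieldTheory.Kummer

variable {F₁ : Type u} [Field F₁] [CharZero F₁] [Literature.ModelTheory.ExponentialFields.ExponentialRing F₁]
variable {F₂ : Type u} [Field F₂] [CharZero F₂] [Literature.ModelTheory.ExponentialFields.ExponentialRing F₂]
variable (kk : Type u) {kk' : Type u} [Field kk] [Field kk'] [Algebra kk F₁] [Algebra kk' F₂]
  (θ : kk ≃+* kk') {k : ℕ} (a : Fin k → F₁) {x : Fin k → F₂}
  (hgen : IsGenericPt (LocusComponents.idealMapCoeff θ (locIdeal kk (gammaPt a))) (gammaPt x))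
  (N : ℕ) {r : ℕ} (S : Set F₁) (b : Fin r → F₁)

variable {kk a N S b}

include hgen in
set_option maxHeartbeats 1000000 in
/-- **The isomorphism step (core), into the second field.** As `exists_ringHom_isoCore`, with the
coefficient field `kk → F₁` (the Γ-field `A = ⟨K₁ c⟩`), `θ : kk ≅ kk'` onto a coefficient field
`kk' → F₂` (the cross Γ-isomorphism `A ≅ A'`), `X ≤ F₁` (`= Γ₁(A)`), `a` in `F₁` with
`(x, exp x)` a generic point in `F₂` of `θ(loc((a, exp a)/kk))`, and the base field
`L = ℚ(μ_∞ ∪ S ∪ exp a ∪ √b) ⊆ F₁` of the Kummer fact. Then there is a subfield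
`D ⊇ ℚ(Γ(X + ℚ(N a)))` of `F₁` and a ring homomorphism `Θ : D → F₂` which is `θ` on `kk`, sends
`N aⱼ ↦ N xⱼ`, and satisfies `Θ (exp y) = exp (Θ y)` for `y ∈ X + ℚ(N a)` — the embedding
"`C ≅ B` over `A`" of Bays–Kirby 2018, Lemma 8.3, for `B` presented in another field (Def. 5.14).
[cite: BaysKirby2018ANT, Lemma 8.3 (proof), Def. 3.19, Prop. 3.22, Def. 5.14] -/
theorem exists_ringHom_isoCore₂ (X : Submodule ℚ F₁)
    (hLR : Lb a S b ≤ Rfld kk (gammaPt a))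
    (hXL : (X : Set F₁) ⊆ Lb a S b) (hexpXL : exp '' (X : Set F₁) ⊆ Lb a S b)
    (hkkL : ∀ y : kk, algebraMap kk F₁ y ∈ Lb a S b) (heL : ∀ j, (N : F₁) * a j ∈ Lb a S b)
    (hXkk : ∀ v ∈ X, ∃ y : kk, algebraMap kk F₁ y = v)
    (hexpXkk : ∀ v ∈ X, ∃ y : kk, algebraMap kk F₁ y = exp v)
    (hθexp : ∀ y₀ y₁ : kk, algebraMap kk F₁ y₀ ∈ X → algebraMap kk F₁ y₁ = exp (algebraMap kk F₁ y₀) →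
      algebraMap kk' F₂ (θ y₁) = exp (algebraMap kk' F₂ (θ y₀)))
    (hKum : KummerConclusion a S b) :
    ∃ (D : Subfield F₁) (Θ : D →+* F₂),
      gens (X ⊔ Submodule.span ℚ (range fun j => (N : F₁) * a j)) ⊆ D ∧
      (∀ (y : kk) (h : algebraMap kk F₁ y ∈ D), Θ ⟨algebraMap kk F₁ y, h⟩ = algebraMap kk' F₂ (θ y)) ∧
      (∀ (j : Fin k) (h : (N : F₁) * a j ∈ D), Θ ⟨(N : F₁) * a j, h⟩ = (N : F₂) * x j) ∧
      (∀ y ∈ X ⊔ Submodule.span ℚ (range fun j => (N : F₁) * a j), ∀ (h : y ∈ D) (h' : exp y ∈ D),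
        Θ ⟨exp y, h'⟩ = exp (Θ ⟨y, h⟩)) := by
  classical
  set p := gammaPt a with hp
  set e : Fin k → F₁ := fun j => (N : F₁) * a j with he
  -- the embedding `ι` restricted to `L`
  set ι : Rfld kk p →+* F₂ := iota₂ kk θ p hgen with hι
  let ιL : Lb a S b →+* F₂ := ι.comp (Subfield.inclusion hLR)
  have hιL : ∀ (y : F₁) (hy : y ∈ Lb a S b), ιL ⟨y, hy⟩ = ι ⟨y, hLR hy⟩ := fun _ _ => rfl
  -- the two division systems
  set ρ : ℕ+ → Fin k → F₁ := rho a with hρ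
  set σ' : ℕ+ → Fin k → F₂ := rho x with hσ'
  have hρsys : IsDivisionSystem (expTuple a) ρ := isDivisionSystem_rho a
  -- `ι (exp aⱼ) = exp xⱼ`
  have hιexp : ∀ j, ιL ⟨exp (a j), Subfield.subset_closure
      (Or.inl (Or.inr (Or.inr ⟨j, rfl⟩)))⟩ = exp (x j) := by
    intro j
    rw [hιL]
    have := iota₂_apply_coord kk θ p hgen (Sum.inr j)
    simp only [hp, gammaPt_inr] at this
    exact this
  -- Kummer, instantiated at the algebra structure `ιL` on `F₂`
  have hσsys : IsDivisionSystem
      (fun j => algebraMap (Lb a S b) (Twisted ιL) (baseTuple S b (expTuple a) j))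
      (fun q j => Twisted.of ιL (σ' q j)) := by
    refine ⟨?_, fun m q j => ?_⟩
    · funext j
      change rho x 1 j = ιL (baseTuple S b (expTuple a) j)
      have h1 : (baseTuple S b (expTuple a) j : Lb a S b) =
          ⟨exp (a j), Subfield.subset_closure (Or.inl (Or.inr (Or.inr ⟨j, rfl⟩)))⟩ := Subtype.ext rfl
      rw [h1, hιexp j]
      simp [rho]
    · exact (isDivisionSystem_rho x).2 m q j
  have hkerEq := hKum ρ hρsys (Twisted ιL) (fun q j => Twisted.of ιL (σ' q j)) hσsys
  rw [Twisted.ker_aeval_eq] at hkerEq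
  -- the ring homomorphism `Ξ : L(ρ) → F₂`
  set E : IntermediateField (Lb a S b) F₁ :=
    IntermediateField.adjoin (Lb a S b) (range fun q : ℕ+ × Fin k => ρ q.1 q.2) with hE
  have hiff : ∀ P : MvPolynomial (ℕ+ × Fin k) (Lb a S b),
      aeval (fun q : ℕ+ × Fin k => ρ q.1 q.2) P = 0 ↔
        eval₂ ιL (fun q : ℕ+ × Fin k => σ' q.1 q.2) P = 0 := fun P => by
    have h := SetLike.ext_iff.1 hkerEq P
    rwa [RingHom.mem_ker, RingHom.mem_ker, coe_eval₂Hom] at h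
  let Ξ := pointFieldHom₂ ιL (fun q : ℕ+ × Fin k => ρ q.1 q.2) (fun q : ℕ+ × Fin k => σ' q.1 q.2) hiff
  have hΞL : ∀ l : Lb a S b, Ξ (algebraMap (Lb a S b) E l) = ιL l :=
    pointFieldHom₂_algebraMap ιL _ _ hiff
  have hΞρ : ∀ i : ℕ+ × Fin k, Ξ ⟨ρ i.1 i.2, IntermediateField.subset_adjoin (Lb a S b) _ ⟨i, rfl⟩⟩ =
      σ' i.1 i.2 := fun i => pointFieldHom₂_apply_self ιL _ _ hiff i
  -- membership facts
  have hLE : ∀ y ∈ Lb a S b, y ∈ E := fun y hy => E.algebraMap_mem ⟨y, hy⟩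
  have hρE : ∀ (q : ℕ+) j, ρ q j ∈ E := fun q j =>
    IntermediateField.subset_adjoin (Lb a S b) _ ⟨(q, j), rfl⟩
  have hexpe_eq : ∀ (j : Fin k) (q : ℚ), exp (q • e j) = ρ ⟨q.den, q.den_pos⟩ j ^ ((N : ℤ) * q.num) := by
    intro j q
    rw [exp_rat_smul_eq_zpow_den]
    have h2 : exp (e j / (q.den : F₁)) = ρ ⟨q.den, q.den_pos⟩ j ^ (N : ℤ) := by
      simp only [he, hρ, rho, PNat.mk_coe, zpow_natCast]
      rw [← exp_nsmul, nsmul_eq_mul, mul_div_assoc]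
    rw [h2, ← zpow_mul]
  have hexpeE : ∀ (j : Fin k) (q : ℚ), exp (q • e j) ∈ E := by
    intro j q
    rw [hexpe_eq]
    exact zpow_mem (hρE _ j) _
  have hYE : ∀ y ∈ X ⊔ Submodule.span ℚ (range e), y ∈ E ∧ exp y ∈ E := by
    intro y hy
    obtain ⟨x₀, hx₀, v, hv, rfl⟩ := Submodule.mem_sup.1 hy
    obtain ⟨q, rfl⟩ := (Submodule.mem_span_range_iff_exists_fun ℚ).1 hv
    constructor
    · refine add_mem (hLE _ (hXL hx₀)) (sum_mem fun j _ => ?_)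
      rw [Rat.smul_def]
      exact mul_mem (hLE _ (SubfieldClass.ratCast_mem (Lb a S b) (q j))) (hLE _ (heL j))
    · rw [exp_add, exp_univ_sum]
      exact mul_mem (hLE _ (hexpXL ⟨x₀, hx₀, rfl⟩)) (prod_mem fun j _ => hexpeE j (q j))
  let Θ : E.toSubfield →+* F₂ :=
    { toFun := fun y => Ξ ⟨y.1, y.2⟩
      map_one' := Ξ.map_one
      map_mul' := fun y y' => Ξ.map_mul ⟨y.1, y.2⟩ ⟨y'.1, y'.2⟩
      map_zero' := Ξ.map_zero
      map_add' := fun y y' => Ξ.map_add ⟨y.1, y.2⟩ ⟨y'.1, y'.2⟩ }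
  refine ⟨E.toSubfield, Θ, ?_, ?_, ?_, ?_⟩
  · -- `gens ⊆ E`
    rintro y (hy | ⟨v, hv, rfl⟩)
    · exact (hYE y hy).1
    · exact (hYE v hv).2
  · -- `Θ` on `kk`
    intro y h
    change Ξ ⟨algebraMap kk F₁ y, h⟩ = _
    have h1 : (⟨algebraMap kk F₁ y, h⟩ : E) = algebraMap (Lb a S b) E ⟨algebraMap kk F₁ y, hkkL y⟩ :=
      Subtype.ext rfl
    rw [h1, hΞL, hιL]
    exact iota₂_algebraMap kk θ p hgen y
  · -- `Θ` on `N aⱼ`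
    intro j h
    change Ξ ⟨(N : F₁) * a j, h⟩ = _
    have h1 : (⟨(N : F₁) * a j, h⟩ : E) = algebraMap (Lb a S b) E ⟨(N : F₁) * a j, heL j⟩ :=
      Subtype.ext rfl
    rw [h1, hΞL, hιL]
    have := iota₂_natCast_mul kk θ p hgen N (Sum.inl j)
    simp only [hp, gammaPt_inl] at this
    exact this
  · -- `Θ (exp y) = exp (Θ y)` on `X + ℚe`
    intro y hy h h'
    change Ξ ⟨exp y, h'⟩ = exp (Ξ ⟨y, h⟩)
    obtain ⟨x₀, hx₀, v, hv, rfl⟩ := Submodule.mem_sup.1 hy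
    obtain ⟨q, rfl⟩ := (Submodule.mem_span_range_iff_exists_fun ℚ).1 hv
    obtain ⟨y₀, hy₀⟩ := hXkk x₀ hx₀
    obtain ⟨y₁, hy₁⟩ := hexpXkk x₀ hx₀
    -- values of `Ξ` on the pieces
    have hΞx₀ : Ξ ⟨x₀, hLE _ (hXL hx₀)⟩ = algebraMap kk' F₂ (θ y₀) := by
      have h1 : (⟨x₀, hLE _ (hXL hx₀)⟩ : E) = algebraMap (Lb a S b) E ⟨algebraMap kk F₁ y₀, hkkL y₀⟩ :=
        Subtype.ext hy₀.symm
      rw [h1, hΞL, hιL]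
      exact iota₂_algebraMap kk θ p hgen y₀
    have hΞexpx₀ : Ξ ⟨exp x₀, hLE _ (hexpXL ⟨x₀, hx₀, rfl⟩)⟩ = exp (algebraMap kk' F₂ (θ y₀)) := by
      have h1 : (⟨exp x₀, hLE _ (hexpXL ⟨x₀, hx₀, rfl⟩)⟩ : E) =
          algebraMap (Lb a S b) E ⟨algebraMap kk F₁ y₁, hkkL y₁⟩ := Subtype.ext hy₁.symm
      rw [h1, hΞL, hιL, iota₂_algebraMap kk θ p hgen y₁]
      exact hθexp y₀ y₁ (hy₀ ▸ hx₀) (hy₁.trans (by rw [hy₀]))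
    have hΞe : ∀ j, Ξ ⟨e j, hLE _ (heL j)⟩ = (N : F₂) * x j := by
      intro j
      have h1 : (⟨e j, hLE _ (heL j)⟩ : E) = algebraMap (Lb a S b) E ⟨(N : F₁) * a j, heL j⟩ :=
        Subtype.ext rfl
      rw [h1, hΞL, hιL]
      have := iota₂_natCast_mul kk θ p hgen N (Sum.inl j)
      simp only [hp, gammaPt_inl] at this
      exact this
    have hΞρ' : ∀ (d : ℕ+) j, Ξ ⟨ρ d j, hρE d j⟩ = σ' d j := fun d j => by
      have := hΞρ (d, j)
      exact this
    have hΞexpe : ∀ j, Ξ ⟨exp (q j • e j), hexpeE j (q j)⟩ = exp (q j • ((N : F₂) * x j)) := by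
      intro j
      have h1 : (⟨exp (q j • e j), hexpeE j (q j)⟩ : E) =
          ⟨ρ ⟨(q j).den, (q j).den_pos⟩ j, hρE _ j⟩ ^ ((N : ℤ) * (q j).num) :=
        Subtype.ext (by push_cast; exact hexpe_eq j (q j))
      rw [h1, map_zpow₀, hΞρ']
      -- the same computation on the `x` side
      rw [exp_rat_smul_eq_zpow_den]
      have h2 : exp ((N : F₂) * x j / ((q j).den : F₂)) = σ' ⟨(q j).den, (q j).den_pos⟩ j ^ (N : ℤ) := by
        simp only [hσ', rho, PNat.mk_coe, zpow_natCast]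
        rw [← exp_nsmul, nsmul_eq_mul, mul_div_assoc]
      rw [h2, ← zpow_mul]
    -- decompose `y` and `exp y` inside `E`
    have hy1 : (⟨x₀ + ∑ j, q j • e j, h⟩ : E) =
        ⟨x₀, hLE _ (hXL hx₀)⟩ + ∑ j, ((q j : ℚ) : E) * ⟨e j, hLE _ (heL j)⟩ :=
      Subtype.ext (by push_cast; simp [Rat.smul_def])
    have hy2 : (⟨exp (x₀ + ∑ j, q j • e j), h'⟩ : E) =
        ⟨exp x₀, hLE _ (hexpXL ⟨x₀, hx₀, rfl⟩)⟩ * ∏ j, ⟨exp (q j • e j), hexpeE j (q j)⟩ :=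
      Subtype.ext (by push_cast; rw [exp_add, exp_univ_sum])
    rw [hy1, hy2, map_mul, map_prod, map_add, map_sum]
    simp only [map_mul, map_ratCast, hΞx₀, hΞexpx₀, hΞe, hΞexpe]
    rw [exp_add, exp_univ_sum]
    congr 1
    refine Finset.prod_congr rfl fun j _ => ?_
    rw [Rat.smul_def]

end IsoCore₂

/-! ### The cross-field main case of the saturation theorem -/

section MainCase₂

open Literature.FieldTheory.Kummer

variable {F₁ : Type u} [Field F₁] [CharZero F₁] [Literature.ModelTheory.ExponentialFields.ExponentialRing F₁]
variable {F₂ : Type u} [Field F₂] [CharZero F₂] [Literature.ModelTheory.ExponentialFields.ExponentialRing F₂]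

set_option maxHeartbeats 800000 in
set_option synthInstance.maxHeartbeats 200000 in
/-- **Cross-field `ℵ₀`-saturation for Γ-algebraic extensions, main case** (Bays–Kirby 2018,
Lemma 8.3 (⟹) with Def. 5.14, for extensions `A ◁ B` with `A^full ∧ B = A`, the extension being
presented in ANOTHER field): let `F₁` be an exponential field with `ker exp = τ₁ℤ` (`τ₁ ≠ 0`),
`F₂` algebraically closed and strongly exponentially-algebraically closed, `σ₀ : ℚ^{ab}(τ₁) ≅
ℚ^{ab}(τ₂)` an isomorphism of the base Γ-fields `fieldOf (ℚτ₁) ≃ fieldOf (ℚτ₂)`; let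
`ℚτ₁ + ℚc ◁ F₁`, `ℚτ₂ + ℚc' ◁ F₂`, `c ↦ c'` a cross Γ-isomorphism over `σ₀`, and `e` a `k`-tuple
of `F₁` linearly independent over `X = ℚτ₁ + ℚc` with `td(e/X) = k` such that no non-trivial
`ℤ`-combination of `e`, nor its exponential, is algebraic over `ℚ(Γ(X))`. Granted the Kummer fact
`Literature.FieldTheory.Kummer.BaysKirby2018_divisionSequences_determined`, there is `e'` in `F₂`
with `(c, e) ↦ (c', e')` a cross Γ-isomorphism over `σ₀` and `ℚτ₂ + ℚc' + ℚe' ◁ F₂`.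
[cite: BaysKirby2018ANT, Lemma 8.3 (proof), Def. 5.14] -/
theorem exists_isGammaIsoTw₂_append_of_free [IsAlgClosed F₂] (hSEAC : IsStronglyExpAlgClosed F₂)
    {τ₁ : F₁} (hker : expKernel F₁ = AddSubgroup.zmultiples τ₁) (hτ : τ₁ ≠ 0) {τ₂ : F₂}
    (hKfact : BaysKirby2018_divisionSequences_determined.{u})
    {σ₀ : fieldOf (Submodule.span ℚ ({τ₁} : Set F₁)) ≃+* fieldOf (Submodule.span ℚ ({τ₂} : Set F₂))}
    (hσ₀ : IsEBaseIso₂ (Submodule.span ℚ ({τ₁} : Set F₁)) (Submodule.span ℚ ({τ₂} : Set F₂)) σ₀)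
    {N k : ℕ} {c : Fin N → F₁} {c' : Fin N → F₂} {e : Fin k → F₁}
    (hX : IsStrong (Submodule.span ℚ {τ₁} ⊔ Submodule.span ℚ (range c)))
    (hX' : IsStrong (Submodule.span ℚ {τ₂} ⊔ Submodule.span ℚ (range c')))
    (hiso : IsGammaIsoTw₂ σ₀ c c')
    (hlin : LinIndepOver (Submodule.span ℚ {τ₁} ⊔ Submodule.span ℚ (range c)) e)
    (htd : td (Submodule.span ℚ {τ₁} ⊔ Submodule.span ℚ (range c)) (Submodule.span ℚ (range e)) = k)
    (hfree : ∀ m : Fin k → ℤ, m ≠ 0 →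
      ∑ j, (m j : ℚ) • e j ∉ acl (gens (Submodule.span ℚ {τ₁} ⊔ Submodule.span ℚ (range c))) ∧
      exp (∑ j, (m j : ℚ) • e j) ∉ acl (gens (Submodule.span ℚ {τ₁} ⊔ Submodule.span ℚ (range c)))) :
    ∃ e' : Fin k → F₂, IsGammaIsoTw₂ σ₀ (Fin.append c e) (Fin.append c' e') ∧
      IsStrong (Submodule.span ℚ {τ₂} ⊔ Submodule.span ℚ (range (Fin.append c' e'))) := by
  classical
  set X := (Submodule.span ℚ ({τ₁} : Set F₁)) ⊔ Submodule.span ℚ (range c) with hXdef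
  set X' := (Submodule.span ℚ ({τ₂} : Set F₂)) ⊔ Submodule.span ℚ (range c') with hX'def
  have hτX : τ₁ ∈ X := Submodule.mem_sup_left (Submodule.subset_span rfl)
  -- Step 1: a basis `u = c ∘ σ` of `X` modulo `ℚτ₁`
  obtain ⟨r, σ, hu, hspan⟩ := exists_linIndepOver_comp (Submodule.span ℚ ({τ₁} : Set F₁)) c
  set u : Fin r → F₁ := c ∘ σ with hudef
  have hXu : X = (Submodule.span ℚ ({τ₁} : Set F₁)) ⊔ Submodule.span ℚ (range u) := by rw [hXdef, ← hspan]
  -- Step 2: the Kummer fact (in `F₁`)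
  set S : Set F₁ := {τ₁} ∪ range c ∪ range e with hSdef
  have hSfin : S.Finite := ((finite_singleton τ₁).union (finite_range c)).union (finite_range e)
  set b : Fin r → F₁ := fun l => exp (u l) with hbdef
  set cK : Fin k → F₁ := fun j => exp (e j) with hcK
  have hb0 : ∀ l, b l ≠ 0 := fun l => exp_ne_zero _
  have hc0 : ∀ j, cK j ≠ 0 := fun j => exp_ne_zero _
  have hue : LinIndepOver (Submodule.span ℚ ({τ₁} : Set F₁)) (Fin.append u e) := hu.append (by rwa [← hXu])
  have hind : MulIndepModTorsion (Fin.append b cK) := by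
    have : Fin.append b cK = fun i => exp (Fin.append u e i) := by
      rw [comp_append]; rfl
    rw [this]
    exact mulIndepModTorsion_exp hker hue
  obtain ⟨m, hm, H⟩ := hKfact S hSfin b cK hb0 hc0 hind
  -- Step 3: the rescaled basis `a = e / m`
  have hm0 : (m : F₁) ≠ 0 := Nat.cast_ne_zero.2 hm.ne'
  set a : Fin k → F₁ := fun j => e j / (m : F₁) with hadef
  have hea : ∀ j, (m : F₁) * a j = e j := fun j => by simp only [hadef]; field_simp
  have hea' : (fun j => (m : F₁) * a j) = e := funext hea
  have haq : a = fun j => ((m : ℚ)⁻¹) • e j := by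
    funext j; simp only [hadef]; exact div_natCast_eq_smul (e j) m
  have ha : LinIndepOver X a := by
    rw [haq]; exact hlin.smul (inv_ne_zero (Nat.cast_ne_zero.2 hm.ne'))
  have hspan_a : Submodule.span ℚ (range a) = Submodule.span ℚ (range e) := by
    apply le_antisymm
    · refine Submodule.span_le.2 ?_
      rintro _ ⟨j, rfl⟩
      rw [haq]
      exact Submodule.smul_mem _ _ (Submodule.subset_span ⟨j, rfl⟩)
    · refine Submodule.span_le.2 ?_
      rintro _ ⟨j, rfl⟩
      rw [← hea j, ← nsmul_eq_mul]
      exact Submodule.smul_of_tower_mem _ m (Submodule.subset_span ⟨j, rfl⟩)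
  have htda : td X (Submodule.span ℚ (range a)) = k := by rw [hspan_a]; exact htd
  have hfreea : ∀ n : Fin k → ℤ, n ≠ 0 →
      ∑ j, (n j : ℚ) • a j ∉ acl (gens X) ∧ exp (∑ j, (n j : ℚ) • a j) ∉ acl (gens X) := by
    intro n hn
    have hsum : ∑ j, (n j : ℚ) • a j = ((m : ℚ)⁻¹) • ∑ j, (n j : ℚ) • e j := by
      rw [Finset.smul_sum]
      refine Finset.sum_congr rfl fun j _ => ?_
      rw [haq, smul_comm]
    rw [hsum, smul_mem_acl_iff (inv_ne_zero (Nat.cast_ne_zero.2 hm.ne'))]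
    refine ⟨(hfree n hn).1, fun h => (hfree n hn).2 ?_⟩
    have : exp (∑ j, (n j : ℚ) • e j) = exp (((m : ℚ)⁻¹) • ∑ j, (n j : ℚ) • e j) ^ m := by
      rw [← exp_nsmul, ← Nat.cast_smul_eq_nsmul ℚ, smul_smul, mul_inv_cancel₀
        (Nat.cast_ne_zero.2 hm.ne'), one_smul]
    rw [this]
    obtain ⟨A, hA, -⟩ := exists_subalgebra_eq_acl (gens X)
    rw [← hA] at h ⊢
    exact pow_mem h m
  have hKum : KummerConclusion a S b := by
    intro ρ hρ Ω₂ _ _ σσ hσσ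
    exact H (expTuple a) (fun j => by
      change exp (a j) ^ m = exp (e j)
      rw [← exp_nsmul, nsmul_eq_mul, hea]) ρ hρ Ω₂ σσ hσσ
  -- Step 4: the generic partner on the `c'` side, in `F₂`
  set T : Finset F₂ := insert τ₂ (Finset.univ.image c') with hTdef
  have hT : Submodule.span ℚ (↑T : Set F₂) = X' := by
    rw [hTdef, Finset.coe_insert, Finset.coe_image, Finset.coe_univ, Set.image_univ,
      Submodule.span_insert]
  obtain ⟨x, hgen, hlinx, htdx⟩ :=
    exists_generic_partner₂ (Submodule.span ℚ ({τ₁} : Set F₁)) (Submodule.span ℚ ({τ₂} : Set F₂)) hiso a hSEAC hX hX' ha htda hfreea T hT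
  -- Step 5: the isomorphism step
  set kk : IntermediateField (fieldOf (Submodule.span ℚ ({τ₁} : Set F₁))) F₁ := bfld (Submodule.span ℚ ({τ₁} : Set F₁)) c with hkk
  set kk' : IntermediateField (fieldOf (Submodule.span ℚ ({τ₂} : Set F₂))) F₂ := bfld (Submodule.span ℚ ({τ₂} : Set F₂)) c' with hkk'
  set θ := hiso.fieldEquiv with hθ
  have hfX_R : ∀ y ∈ fieldOf X, y ∈ Rfld kk (gammaPt a) := fun y hy =>
    algebraMap_mem_Rfld kk (gammaPt a) ⟨y, (mem_adjoinField_allGens_iff (Submodule.span ℚ ({τ₁} : Set F₁)) c).2 hy⟩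
  have hrootsL : ∀ (d : ℕ), 0 < d → exp (τ₁ / (d : F₁)) ∈ Lb a S b := by
    intro d hd
    refine Literature.FieldTheory.Kummer.mem_baseField_of_mem_allRoots_one _ ⟨d, hd, ?_⟩
    rw [← exp_nsmul, nsmul_eq_mul, mul_div_cancel₀ _ (Nat.cast_ne_zero.2 hd.ne'), exp_tau_eq_one hker]
  have hurootsL : ∀ (l : Fin r) (d : ℕ), 0 < d → exp (u l / (d : F₁)) ∈ Lb a S b := by
    intro l d hd
    refine Literature.FieldTheory.Kummer.mem_baseField_of_mem_allRoots _ l ⟨d, hd, ?_⟩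
    rw [← exp_nsmul, nsmul_eq_mul, mul_div_cancel₀ _ (Nat.cast_ne_zero.2 hd.ne')]
  have hexpX_L : ∀ y ∈ X, exp y ∈ Lb a S b := by
    intro y hy
    rw [hXu] at hy
    obtain ⟨y₀, hy₀, y₁, hy₁, rfl⟩ := Submodule.mem_sup.1 hy
    rw [exp_add]
    refine mul_mem ?_ (exp_mem_of_mem_span hurootsL hy₁)
    have hy₀' : y₀ ∈ Submodule.span ℚ (range ![τ₁]) := by simpa using hy₀
    exact exp_mem_of_mem_span (w := ![τ₁]) (fun i d hd => by simpa using hrootsL d hd) hy₀'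
  have hS_L : S ⊆ Lb a S b := fun y hy => Literature.FieldTheory.Kummer.mem_baseField_of_mem _ (Or.inl hy)
  have hX_L : (X : Set F₁) ⊆ Lb a S b := by
    intro y hy
    have hy' : y ∈ Submodule.span ℚ ({τ₁} ∪ range c) := by
      rw [Submodule.span_union]; exact hy
    exact mem_subfield_of_mem_span (fun z hz => hS_L (Or.inl hz)) hy'
  have hgensX_L : gens X ⊆ Lb a S b := by
    rintro y (hy | ⟨v, hv, rfl⟩)
    · exact hX_L hy
    · exact hexpX_L v hv
  have hfX_L : ∀ y ∈ fieldOf X, y ∈ Lb a S b := fun y hy =>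
    fieldOf_subset_of_gens_subset hgensX_L hy
  have hLR : Lb a S b ≤ Rfld kk (gammaPt a) := by
    refine Subfield.closure_le.2 ?_
    rintro y ((h1 | hS') | hbr)
    · obtain ⟨v, hv, rfl⟩ := allRoots_one_subset hker hτ hτX h1
      exact hfX_R _ (exp_mem_fieldOf hv)
    · rcases hS' with hS'' | ⟨j, rfl⟩
      · rcases hS'' with (hτ' | ⟨i, rfl⟩) | ⟨j, rfl⟩
        · rw [mem_singleton_iff.1 hτ']
          exact hfX_R _ (mem_fieldOf_of_mem hτX)
        · exact hfX_R _ (mem_fieldOf_of_mem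
            (Submodule.mem_sup_right (Submodule.subset_span ⟨i, rfl⟩)))
        · rw [← hea j]
          exact natCast_mul_mem_Rfld kk (gammaPt a) m (Sum.inl j)
      · exact apply_mem_Rfld kk (gammaPt a) (Sum.inr j)
    · obtain ⟨l, hl⟩ := mem_iUnion.1 hbr
      obtain ⟨v, hv, rfl⟩ := allRoots_exp_subset hker hτ hτX
        (show u l ∈ X from by rw [hXu]; exact Submodule.mem_sup_right (Submodule.subset_span ⟨l, rfl⟩)) hl
      exact hfX_R _ (exp_mem_fieldOf hv)
  have hkkL : ∀ y : kk, algebraMap kk F₁ y ∈ Lb a S b := fun y =>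
    hfX_L _ ((mem_adjoinField_allGens_iff (Submodule.span ℚ ({τ₁} : Set F₁)) c).1 y.2)
  have heL : ∀ j, (m : F₁) * a j ∈ Lb a S b := fun j => by
    rw [hea j]; exact hS_L (Or.inr ⟨j, rfl⟩)
  have hXkk : ∀ v ∈ X, ∃ y : kk, algebraMap kk F₁ y = v := fun v hv =>
    ⟨⟨v, (mem_adjoinField_allGens_iff (Submodule.span ℚ ({τ₁} : Set F₁)) c).2 (mem_fieldOf_of_mem hv)⟩, rfl⟩
  have hexpXkk : ∀ v ∈ X, ∃ y : kk, algebraMap kk F₁ y = exp v := fun v hv =>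
    ⟨⟨exp v, (mem_adjoinField_allGens_iff (Submodule.span ℚ ({τ₁} : Set F₁)) c).2 (exp_mem_fieldOf hv)⟩, rfl⟩
  have hθexp : ∀ y₀ y₁ : kk, algebraMap kk F₁ y₀ ∈ X →
      algebraMap kk F₁ y₁ = exp (algebraMap kk F₁ y₀) →
      algebraMap kk' F₂ (θ y₁) = exp (algebraMap kk' F₂ (θ y₀)) := by
    rintro ⟨v₀, hv₀⟩ ⟨v₁, hv₁⟩ hy₀ hy₁
    change v₀ ∈ X at hy₀
    change v₁ = exp v₀ at hy₁
    subst hy₁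
    exact (hiso.fieldEquiv_exp hσ₀ hy₀).2
  obtain ⟨D, Θ, hgensD, hΘkk, hΘe, hΘexp⟩ := exists_ringHom_isoCore₂ θ hgen X hLR hX_L
    (by rintro _ ⟨v, hv, rfl⟩; exact hexpX_L v hv) hkkL heL hXkk hexpXkk hθexp hKum
  rw [hea'] at hgensD hΘexp
  -- Step 6: the ring homomorphism on `⟨ℚτ₁, c, e⟩`
  set e' : Fin k → F₂ := fun j => (m : F₂) * x j with he'
  have hY : (Submodule.span ℚ ({τ₁} : Set F₁)) ⊔ Submodule.span ℚ (range (Fin.append c e)) = X ⊔ Submodule.span ℚ (range e) := by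
    rw [ZilberHomogeneity.range_append, Submodule.span_union, hXdef, sup_assoc]
  have hY' : (Submodule.span ℚ ({τ₂} : Set F₂)) ⊔ Submodule.span ℚ (range (Fin.append c' e')) = X' ⊔ Submodule.span ℚ (range e') := by
    rw [ZilberHomogeneity.range_append, Submodule.span_union, hX'def, sup_assoc]
  set E₂ : IntermediateField (fieldOf (Submodule.span ℚ ({τ₁} : Set F₁))) F₁ :=
    IntermediateField.adjoin (fieldOf (Submodule.span ℚ ({τ₁} : Set F₁))) (allGens (Fin.append c e)) with hE₂
  have hE₂D : ∀ y ∈ E₂, y ∈ D := by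
    intro y hy
    have hy' : y ∈ fieldOf (X ⊔ Submodule.span ℚ (range e)) := by
      rw [← hY]; exact (mem_adjoinField_allGens_iff (Submodule.span ℚ ({τ₁} : Set F₁)) (Fin.append c e)).1 hy
    exact fieldOf_subset_of_gens_subset hgensD hy'
  let Θ' : E₂ →+* F₂ :=
    { toFun := fun y => Θ ⟨y.1, hE₂D y.1 y.2⟩
      map_one' := Θ.map_one
      map_mul' := fun y y' => Θ.map_mul ⟨y.1, hE₂D y.1 y.2⟩ ⟨y'.1, hE₂D y'.1 y'.2⟩
      map_zero' := Θ.map_zero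
      map_add' := fun y y' => Θ.map_add ⟨y.1, hE₂D y.1 y.2⟩ ⟨y'.1, hE₂D y'.1 y'.2⟩ }
  have hΘ' : ∀ (y : F₁) (hy : y ∈ E₂), Θ' ⟨y, hy⟩ = Θ ⟨y, hE₂D y hy⟩ := fun _ _ => rfl
  -- values of `Θ'` on `⟨K c⟩`
  have hΘ'kk : ∀ (y : F₁) (hy : y ∈ kk) (hy' : y ∈ E₂), Θ' ⟨y, hy'⟩ = (θ ⟨y, hy⟩ : F₂) := by
    intro y hy hy'
    rw [hΘ']
    exact hΘkk ⟨y, hy⟩ (hE₂D y hy')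
  -- Step 7: the cross Γ-isomorphism
  have hisoY : IsGammaIsoTw₂ σ₀ (Fin.append c e) (Fin.append c' e') := by
    refine isGammaIsoTw₂_of_ringHom Θ' (fun κ => ?_) (fun i => ?_) (fun y hy => ?_)
    · -- `σ₀` on `K₀`
      have hκ : (κ : F₁) ∈ kk := (bfld (Submodule.span ℚ ({τ₁} : Set F₁)) c).algebraMap_mem κ
      rw [hΘ'kk _ hκ]
      exact hiso.coe_fieldEquiv_algebraMap κ
    · -- generators
      induction i using Fin.addCases with
      | left i =>
        have hci : c i ∈ kk := mem_adjoinField_of_mem_adjoin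
          (lvAlgebra_le_adjoin_allGens (Submodule.span ℚ ({τ₁} : Set F₁)) 0 c (lvGens_mem_lvAlgebra (Submodule.span ℚ ({τ₁} : Set F₁)) 0 c (Sum.inl i)))
        simp only [Fin.append_left]
        rw [hΘ'kk _ hci]
        have := hiso.coe_fieldEquiv_lvGens 0 (Sum.inl i)
        simpa using this
      | right j =>
        simp only [Fin.append_right]
        rw [hΘ']
        have key : ∀ (h : e j ∈ D), Θ ⟨e j, h⟩ = (m : F₂) * x j := by
          intro h
          have h' : (m : F₁) * a j ∈ D := by rw [hea j]; exact h
          have hsub : (⟨e j, h⟩ : D) = ⟨(m : F₁) * a j, h'⟩ := Subtype.ext (hea j).symm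
          rw [hsub]
          exact hΘe j h'
        exact key _
    · -- compatibility with `exp`
      rw [hΘ', hΘ']
      rw [hY] at hy
      exact hΘexp y hy _ _
  -- Step 8: strongness of `ℚτ₂ + ℚc' + ℚe'`
  refine ⟨e', hisoY, ?_⟩
  rw [hY']
  have hspan_e' : Submodule.span ℚ (range e') = Submodule.span ℚ (range x) := by
    apply le_antisymm
    · refine Submodule.span_le.2 ?_
      rintro _ ⟨j, rfl⟩
      change (m : F₂) * x j ∈ Submodule.span ℚ (range x)
      rw [← nsmul_eq_mul]
      exact Submodule.smul_of_tower_mem _ m (Submodule.subset_span ⟨j, rfl⟩)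
    · refine Submodule.span_le.2 ?_
      rintro _ ⟨j, rfl⟩
      have : x j = ((m : ℚ)⁻¹) • e' j := by
        change x j = ((m : ℚ)⁻¹) • ((m : F₂) * x j)
        rw [← div_natCast_eq_smul]
        field_simp [(Nat.cast_ne_zero.2 hm.ne' : (m : F₂) ≠ 0)]
      rw [this]
      exact Submodule.smul_mem _ _ (Submodule.subset_span ⟨j, rfl⟩)
  rw [hspan_e']
  have hfg : IsFG X' (Submodule.span ℚ (range x)) := isFG_span_of_finite X' (finite_range x)
  refine hX'.of_predim_eq_zero le_sup_left (isFG_sup_left.2 hfg) ?_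
  rw [predim_sup_left, predim_def, ldim_span_eq_of_linIndepOver hlinx, htdx]
  simp

/-- **Cross-field `ℵ₀`-saturation, main case, unconditionally** (the Kummer fact is the theorem
`Literature.FieldTheory.Kummer.BaysKirby2018_divisionSequences_determined_holds`).
[cite: BaysKirby2018ANT, Lemma 8.3 (proof), Def. 5.14] -/
theorem exists_isGammaIsoTw₂_append_of_free' [IsAlgClosed F₂] (hSEAC : IsStronglyExpAlgClosed F₂)
    {τ₁ : F₁} (hker : expKernel F₁ = AddSubgroup.zmultiples τ₁) (hτ : τ₁ ≠ 0) {τ₂ : F₂}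
    {σ₀ : fieldOf (Submodule.span ℚ ({τ₁} : Set F₁)) ≃+* fieldOf (Submodule.span ℚ ({τ₂} : Set F₂))}
    (hσ₀ : IsEBaseIso₂ (Submodule.span ℚ ({τ₁} : Set F₁)) (Submodule.span ℚ ({τ₂} : Set F₂)) σ₀)
    {N k : ℕ} {c : Fin N → F₁} {c' : Fin N → F₂} {e : Fin k → F₁}
    (hX : IsStrong (Submodule.span ℚ {τ₁} ⊔ Submodule.span ℚ (range c)))
    (hX' : IsStrong (Submodule.span ℚ {τ₂} ⊔ Submodule.span ℚ (range c')))
    (hiso : IsGammaIsoTw₂ σ₀ c c')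
    (hlin : LinIndepOver (Submodule.span ℚ {τ₁} ⊔ Submodule.span ℚ (range c)) e)
    (htd : td (Submodule.span ℚ {τ₁} ⊔ Submodule.span ℚ (range c)) (Submodule.span ℚ (range e)) = k)
    (hfree : ∀ m : Fin k → ℤ, m ≠ 0 →
      ∑ j, (m j : ℚ) • e j ∉ acl (gens (Submodule.span ℚ {τ₁} ⊔ Submodule.span ℚ (range c))) ∧
      exp (∑ j, (m j : ℚ) • e j) ∉ acl (gens (Submodule.span ℚ {τ₁} ⊔ Submodule.span ℚ (range c)))) :
    ∃ e' : Fin k → F₂, IsGammaIsoTw₂ σ₀ (Fin.append c e) (Fin.append c' e') ∧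
      IsStrong (Submodule.span ℚ {τ₂} ⊔ Submodule.span ℚ (range (Fin.append c' e'))) :=
  exists_isGammaIsoTw₂_append_of_free hSEAC hker hτ
    Literature.FieldTheory.Kummer.BaysKirby2018_divisionSequences_determined_holds hσ₀ hX hX' hiso
    hlin htd hfree

end MainCase₂

end ZilberSaturationMain

end Literature.NumberTheory.Transcendental
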